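import Mathlib
import HarnessLib
import Summits.HubbardSuperconductivity.HubbardSuperconductivity.Theorems.KLProgrammeKLRegimeEngineTowerWtAssemblyKlEngRowsSharp4
import Summits.HubbardSuperconductivity.HubbardSuperconductivity.Theorems.KLProgrammeKLRegimeEngineTowerBlockZeroPartitionFn
import Summits.HubbardSuperconductivity.HubbardSuperconductivity.Theorems.KLProgrammeKLRegimeEngineScaleOnePartitionFnUnif
import Summits.HubbardSuperconductivity.HubbardSuperconductivity.Theorems.KLProgrammeKLRegimeEngineScaleZeroKernelNormsWt4Q7
import Summits.HubbardSuperconductivity.HubbardSuperconductivity.Theorems.KLProgrammeKLRegimeEngineV8RaiseDoors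
import Summits.HubbardSuperconductivity.HubbardSuperconductivity.Theorems.KLProgrammeKLRegimeEngineTowerImportBindersWt
import Summits.HubbardSuperconductivity.HubbardSuperconductivity.Theorems.KLProgrammeKLRegimeEngineTowerImportWtArrays
import Summits.HubbardSuperconductivity.HubbardSuperconductivity.Theorems.KLProgrammeKLRegimeEngineSixLegInputFamilyCells
import Summits.HubbardSuperconductivity.HubbardSuperconductivity.Theorems.KLProgrammeKLRegimeEngineSixLegImportByJumpWt
import Summits.HubbardSuperconductivity.HubbardSuperconductivity.Theorems.KLProgrammeKLRegimeEngineTowerImportWtCut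

/-!
# Route `KLProgramme` — crux K3 ENGINE (stmt-HubbardSuperconductivity-20437 `KLRegimeEngineV17F2`), ROW (b) binder #5 (E1's (E4) conjunct), cure (α) of located #25
# «(b)-PLAIN-UV-TAIL», LINK 4b: ♯4 FILE D″ «(b)-WT4-ASSEMBLY-∀j» WITH THE TWO WEIGHTED PLAIN FOUR-LEG LINES (import `s₄`, cell `S₄`) STATED FOR THE UV-CUT ELEMENTS
# (cell gate-hubbard-kl, seat hubbard-kl-k3c2-p2 g34; twin of ✓ `kernelNormsWt4_all_klEng_structural_sharp4C2` (k3c3-p2 g18); pen (R669)/(R673))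

WHAT CHANGES vs `…StructuralSharp4C2` (everything else token-identical — head, partition functions, level 0, two- and six-leg input-family cells, numerics, caps, block-0
levels, conclusion): the two E1 four-leg hypotheses — the weighted PLAIN four-leg import line of the block input `𝒱_{dk}[K_n]` (`≤ s₄·(B·ε_j)`) and the weighted PLAIN
four-leg cell line of `𝒱_j[K_n]` (`≤ S₄ j`) — are stated for the leg-rescaled elements `S_ĝ 𝒱 := ExteriorAlgebra.map (LinearMap.mulLeft ℂ ĝ) 𝒱`,
`ĝ((k,σ),c) = gnScaleCutoff 4 klE0 1 |ω_k|` (one-sector UV cut `≡ 1` for `|ω| ≤ klE0`), whose plain currency is M-uniform (located #25: the uncut plain line carries the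
bare vertex's integer-truncation tail `(|U|/24)·Θ_M`, `Θ_M ≍ (ln M)²`, ✓ p765343; the programme's sector multipliers absorb the cut, ✓ p766263/p765436).  The proof is the
original's with the two four-leg suppliers replaced by their `_cut` twins `klWtPinnedSum_four_le_of_wplain_flow_all_cut` / `importBindersWt_of_wplainLines_flow_all_cut4`
(✓ `…TowerImportWtCut`, same constants `CW₄`, `CWi`).
* **`kernelNormsWt4_all_klEng_structural_sharp4C2_cut (R c″)`** ⊢ `∀ j ≤ n, KernelNormsWt4 L M (klWtBudget P Qe U j) β U μ (klFlowFrameU L M β U μ n) j` — same head, same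
  conclusion.
Bookkeeping composition of landed theorems; the E1 rows stay hypotheses; nothing asserts (b), WT4's rows, (ℓ), any stub of 20437, K3, U₀, the window or superconductivity.
References: BGM 2006 §2.3 (2.13)–(2.14), §2.5 (2.48), §2.7 (2.71a), (2.77), §2.8 (2.76)–(2.84), (2.93)–(2.98), Lemma 2.5, §3 (3.2)–(3.8) [cite: BenfattoGiulianiMastropietro2006].
-/

noncomputable section

namespace Summit.HubbardSuperconductivity.HubbardSuperconductivity.Theorems.EngineV8

set_option linter.dupNamespace false -- summit = problem name (single-conjunct summit), D-0017

open Classical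
open Real Finset Literature.MathematicalPhysics.QuantumLattice Literature.Probability.LatticeModels GrassmannAlgebra
open Literature.MathematicalPhysics.QuantumLattice.FermiRG Literature.MathematicalPhysics.QuantumLattice.FermiRG.BGM2006Routing
open Summit.HubbardSuperconductivity.HubbardSuperconductivity.Theorems.KLProgrammeLegKernels
open Summit.HubbardSuperconductivity.HubbardSuperconductivity.Theorems.KLRegimeSplit
open Summit.HubbardSuperconductivity.HubbardSuperconductivity.Theorems.KLRegimeWick
open Summit.HubbardSuperconductivity.HubbardSuperconductivity.Theorems.TwoPointAssembly
open Summit.HubbardSuperconductivity.HubbardSuperconductivity.Theorems.DispersionFlow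
open Summit.HubbardSuperconductivity.HubbardSuperconductivity.Theorems.TorusFourierL2

variable {L M : ℕ} [NeZero L] [NeZero M]

/-! ## The weighted clause at every level, modulo structural E1 inputs, numerics, caps and the block-0 levels — ♯4 -/

set_option maxHeartbeats 400000 in -- one ~230-binder composition instantiated per level (default × 2)
/-- **STUB (b)'s WEIGHTED CLAUSE ON THE FLOW FRAME — ASSEMBLY MODULO STRUCTURAL E1 INPUTS (FOUR-LEG PLAIN LINES UV-CUT), NUMERICS, CAPS AND THE BLOCK-0 LEVELS, ♯4** («D-ORDER» cured;
the six-leg side = ONE input-family sectorised cell under a free amplitude, feeding the imports (k3c2-p3 §1) and the level's `m = 6` clause (§2); see the module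
docstring for the exhaustive input list);
conclusion `∀ j ≤ n, KernelNormsWt4 L M (klWtBudget P Qe U j) β U μ (klFlowFrameU L M β U μ n) j`.
[cite: BenfattoGiulianiMastropietro2006, §2.3 (2.13)-(2.14), §2.7 (2.71a), (2.77), §2.8 (2.76)-(2.84), (2.93)-(2.98), Lemma 2.5 (2.98), §3 (3.2)-(3.8)] -/
theorem kernelNormsWt4_all_klEng_structural_sharp4C2_cut (R : RenConsts) (c'' : ℝ) (hc'' : 0 < c'') :
    ∃ C₁ C₂ Cκ CJ C₁r C₂r Cκr CJr C₁i C₂i : ℝ, 0 < C₁ ∧ 0 < C₂ ∧ 0 < Cκ ∧ 0 < CJ ∧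
      0 < C₁r ∧ 0 < C₂r ∧ 0 < Cκr ∧ 0 < CJr ∧ 0 < C₁i ∧ 0 < C₂i ∧ ∃ CW₄ C₆c : ℝ, 0 < CW₄ ∧ 0 < C₆c ∧
      ∀ d : ℕ, ∃ Cb Cbr : ℝ, 0 < Cb ∧ 0 < Cbr ∧
      ∃ Cinc₁ Dinc₁ : ℝ, 1 ≤ Cinc₁ ∧ 1 ≤ Dinc₁ ∧ ∃ Cκ₀ CJ₀ Cα : ℝ, 0 < Cκ₀ ∧ 0 < CJ₀ ∧ 0 < Cα ∧
      ∃ Cκz Cbz CJz : ℝ, 0 < Cκz ∧ 0 < Cbz ∧ 0 < CJz ∧ ∃ CWi : ℝ, 0 < CWi ∧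
      (R.WF2 → ∃ c₃' : ℝ, 0 < c₃' ∧ ∃ U₀' : ℝ, 0 < U₀' ∧
      ∀ P : SplitConsts, P.WF → ∃ c₀ : ℝ, 0 < c₀ ∧ ∃ U₁ : ℝ, 0 < U₁ ∧
      ∀ (G : GeoConsts) (Q : EngConsts) (c : ℝ), 0 < c → c ≤ klEngC₃6 P R → c ≤ c₃' → c ≤ c₀ →
      ∀ μ ∈ klWindowC, ∀ U : ℝ, 0 < U → U ≤ klEngU₀9 P R c → U ≤ U₀' → U ≤ U₁ → c'' * U ≤ 1 →
      ∀ β : ℝ, klBetaMin ≤ β → β ≤ Real.exp (c / U ^ 2) →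
      ∀ (L M : ℕ) [NeZero L] [NeZero M], klEngL₃ β U ≤ L → klEngM₃ β U L ≤ M →
      ∀ n : ℕ, 1 ≤ n → n ≤ nScales β + 1 → IsKLRegime U c (-(n : ℤ)) → HistP klPredsV17F2 L M G P Q R β U μ 0 n →
        (∀ m', 1 ≤ m' → m' < n → FlowPieceOscAt L M c'' β U μ m') →
      2 ≤ d →
      -- the degree caps [choice: `exists_degreeCap`] (+ block `0`'s input family `F_0`)
      ∀ D : ℕ, 3 ≤ D → (∀ k, 1 ≤ k → d * k ≤ n → Fintype.card (SpaceTimeIdx L M × SectorLeg (sectorCount (d * k - 1))) / 2 ≤ D) →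
        Fintype.card (HubbardFieldIdx L M) ≤ 2 * D + 1 → Fintype.card (SpaceTimeIdx L M × SectorLeg (sectorCount 0)) / 2 ≤ D →
      -- the coupling amplitude and the law's constants
      ∀ (B A Q' Ab Qb : ℝ), 1 ≤ B → 0 ≤ A → 0 < Q' → 0 ≤ Ab → 0 ≤ Qb →
      -- BLOCK 0's BASE LAW (p3 WB3): the block-0 names, the level-0 weighted datum of `𝒱_1` at `(F_0, rate j)` [kit currency], block 0's numerics at `λ_j`
      ∀ (Ab₀ Qb₀ : ℝ), 0 ≤ Ab₀ → 0 ≤ Qb₀ →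
      ∀ (αb₀ κb₀ crb₀ ccb₀ W₀ Z₀ σ₀ τ₀ ψ₀ Φ₀ : ℝ), αb₀ = Cα * ((M : ℝ) / β) → κb₀ = Real.sqrt (2 * Cκ₀ * klE0) → crb₀ = 81 * CJ₀ * M / β →
        ccb₀ = 162 * CJ₀ * M / β → W₀ = 32 * crb₀ / ccb₀ → Z₀ = imagTimeWeight β M ^ 2 * ccb₀ ^ 2 / 8 → σ₀ = κb₀ ^ 2 / ccb₀ ^ 2 →
        τ₀ = 4 * exp 4 * κb₀ ^ 2 / ccb₀ ^ 2 → ψ₀ = ccb₀ ^ 2 / κb₀ ^ 2 → Φ₀ = exp 1 * αb₀ * ccb₀ / (κb₀ ^ 2 * crb₀) →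
      ∀ (A'₀ Q'₀ ι₁₀ ι₂₀ ι₃₀ : ℝ), 0 ≤ A'₀ → 0 < Q'₀ →
      (∀ j, d ≤ j → j ≤ n → ∀ p : ℕ, 3 ≤ p →
        klTowerMeasWtAt L M β U μ (klFlowFrameU L M β U μ n) 1 1 j (2 * p) / klLevUnitF β M 0 p 0 ≤ Ab₀ * (B * epsCoupling P U d) ^ (p - 1) * Qb₀ ^ p) →
      (∀ j, d ≤ j → j ≤ n →
        (∀ m, 4 ≤ m → m ≤ D → W₀ * Z₀ ^ m * (klTowerMeasWtAt L M β U μ (klFlowFrameU L M β U μ n) 1 1 j (2 * m) / klLevUnitF β M 0 m 0) ≤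
          A'₀ * (B * epsCoupling P U d) ^ (m - 1) * Q'₀ ^ m) ∧
        W₀ * Z₀ ^ 3 * (klTowerMeasWtAt L M β U μ (klFlowFrameU L M β U μ n) 1 1 j (2 * 3) / klLevUnitF β M 0 3 0) ≤ ι₃₀ * (B * epsCoupling P U d) ^ 2 ∧
        W₀ * Z₀ ^ 1 * (klTowerMeasWtAt L M β U μ (klFlowFrameU L M β U μ n) 1 1 j (2 * 1) / klLevUnitF β M 0 1 0) ≤ ι₁₀ * (B * epsCoupling P U d) ∧
        W₀ * Z₀ ^ 2 * (klTowerMeasWtAt L M β U μ (klFlowFrameU L M β U μ n) 1 1 j (2 * 2) / klLevUnitF β M 0 2 0) ≤ ι₂₀ * (B * epsCoupling P U d) ∧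
        4 * σ₀ * (B * epsCoupling P U d) * Q'₀ < 1 ∧ 2 * (B * epsCoupling P U d) * τ₀ * Q'₀ ≤ 1 ∧ exp 1 * τ₀ * (B * epsCoupling P U d) * Q'₀ < 1 ∧
        Φ₀ * (τ₀ * (ι₁₀ * (B * epsCoupling P U d) + ι₂₀ / (2 * Q'₀) + ι₃₀ / (4 * Q'₀ ^ 2) + A'₀ * Q'₀ / 4)) < 1 ∧
        Φ₀ * (exp 1 * τ₀ * (ι₁₀ * (B * epsCoupling P U d)) + (exp 1 * τ₀) ^ 2 * (ι₂₀ * (B * epsCoupling P U d)) +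
          (exp 1 * τ₀) ^ 3 * (ι₃₀ * (B * epsCoupling P U d) ^ 2) +
          A'₀ * (exp 1 * τ₀ * Q'₀) * ((exp 1 * τ₀ * (B * epsCoupling P U d) * Q'₀) ^ 3 / (1 - exp 1 * τ₀ * (B * epsCoupling P U d) * Q'₀))) < 1 ∧
        Φ₀ * towerV D τ₀ (fun m => W₀ * Z₀ ^ m *
          (klTowerMeasWtAt L M β U μ (klFlowFrameU L M β U μ n) 1 1 j (2 * m) / klLevUnitF β M 0 m 0)) < 1) →
      ∀ (Aro₁ Qro₁ Qtot₁ Atot₁ : ℝ), Aro₁ = Cinc₁ * Ab₀ → Qro₁ = Dinc₁ * Qb₀ →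
        Qtot₁ = Dinc₁ * max 1 (max Qro₁ (max (4 * Q'₀) (2 * τ₀ * ψ₀ * Q'₀))) →
        (Atot₁ = Aro₁ + Cinc₁ * (A'₀ * (4 * σ₀ * (B * epsCoupling P U d) * Q'₀ / (1 - 4 * σ₀ * (B * epsCoupling P U d) * Q'₀)) +
          exp 1 * (τ₀ * (ι₁₀ * (B * epsCoupling P U d) + ι₂₀ / (2 * Q'₀) + ι₃₀ / (4 * Q'₀ ^ 2) + A'₀ * Q'₀ / 4)) *
            (Φ₀ * (τ₀ * (ι₁₀ * (B * epsCoupling P U d) + ι₂₀ / (2 * Q'₀) + ι₃₀ / (4 * Q'₀ ^ 2) + A'₀ * Q'₀ / 4)) /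
              (1 - Φ₀ * (τ₀ * (ι₁₀ * (B * epsCoupling P U d) + ι₂₀ / (2 * Q'₀) + ι₃₀ / (4 * Q'₀ ^ 2) + A'₀ * Q'₀ / 4)))) / (2 * τ₀ * Q'₀))) →
        (d ≤ n → Atot₁ ≤ Ab) → Qtot₁ = Qb →
      -- BLOCK 0's Z-THREAD (p3 `towerZ_blockZero_klEng`): its four names and the block-0 PLAIN kit guard [numerics, kit currency; read only when `d ≤ n`]
      ∀ (κz αz crz ccz : ℝ), κz = Real.sqrt (2 * Cκz * klE0) → αz = Cbz * ((M : ℝ) / β) * (4 : ℝ) ^ d / klE0 →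
        crz = 81 * CJz * M / β → ccz = 162 * CJz * M / β →
      (d ≤ n → 9 * αz * ccz / ((27 : ℝ) ^ 5 * exp 1 * κz ^ 2 * crz) *
        towerV D (exp 2 * κz ^ 2 / ccz ^ 2)
          (fun m => 64 * (27 : ℝ) ^ 4 * exp 2 * crz / ccz * (exp 4 * ccz ^ 2 * imagTimeWeight β M ^ 2 / 8) ^ m *
            klTowerMuLevF L M β U μ (klFlowFrameU L M β U μ n) 1 1 m) < 1) →
      -- dominants of the LINK's and of the read-out's constants, and the names
      ∀ (κb αb crb ccb : ℝ), Real.sqrt (2 * Cκ * klE0) ≤ κb → Cb * ((M : ℝ) / β) * (4 : ℝ) ^ d / klE0 ≤ αb →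
        81 * CJ * M / β ≤ crb → 162 * CJ * M / β ≤ ccb →
        Real.sqrt (2 * Cκr * klE0) ≤ κb → Cbr * ((M : ℝ) / β) * (4 : ℝ) ^ d / klE0 ≤ αb → 81 * CJr * M / β ≤ crb → 162 * CJr * M / β ≤ ccb →
      ∀ (W Z σ τ ψ Φ : ℝ),
        W = 32 * crb / ccb → Z = imagTimeWeight β M ^ 2 * ccb ^ 2 / 8 →
        σ = κb ^ 2 / ccb ^ 2 → τ = 4 * exp 4 * κb ^ 2 / ccb ^ 2 → ψ = ccb ^ 2 / κb ^ 2 → Φ = exp 1 * αb * ccb / (κb ^ 2 * crb) →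
      ∀ (A' Q'' : ℝ),
        W * ((C₁ / C₂) * (8 : ℝ) ^ (d - 1) * (Ab + A / (1 - ((2 : ℝ) ^ d)⁻¹))) ≤ A' →
        Z * (C₂ ^ 2 * ((2 : ℝ) ^ (d - 1))⁻¹ * max Q' Qb) ≤ Q'' → W * Ab ≤ A' → Z * Qb ≤ Q'' → 0 < Q'' →
      -- the weighted IMPORTS [E1]: the two-leg SECTORISED cell of `𝒱_{dk}[K_n]` AT THE INPUT FAMILY `F_{dk−1}` in the λ-FREE c-class shape `S₂·4^{−(dk−1)}`
      -- (face of record (R431) «(C1″)-TWO-LEG-CELLS-AT-THE-INPUT-FAMILY»; located «(b)-WT4-2LEG-PLAIN-CURRENCY», k3c2-p3 g18: the PLAIN two-leg line carries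
      -- `Im Σ_{>Λ}(iω, k_F) ≍ 0.019·U²` at |ω| ≍ 1 and cannot decay like `4^{−dk}`) and the four-leg PLAIN line `s₄·λ_j` (every block `d·k ≤ j`, every rate `d ≤ j ≤ n`);
      -- the six-leg side = ONE family, the SECTORISED six-leg cell of `𝒱_j[K_n]` AT THE INPUT FAMILY `F_{j−1}` under a
      -- FREE amplitude `S₆·ε_j²·2^{4j}`, `d ≤ j ≤ n` (faces of record (R425)(3) (C1′) + (R423)(C) (D1); p715234 §1's `hcell` shape; STATUS per census rider
      -- «SIX-LEG-CELL-STATUS» (R429): an r2-CLASS OPEN E1 estimate (correlated-counting track), NOT a transcription of BGM 2006 (2.77)) —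
      -- it feeds the six-leg import of every block `k ≥ 2` (§1, by name) AND the level's own `m = 6` clause (§2, one refinement level); no plain six-leg line anywhere
      ∀ (S₂ s₄ S₆ : ℝ), 0 ≤ S₂ → 0 ≤ s₄ → 0 ≤ S₆ →
      (∀ j, d ≤ j → j ≤ n → ∀ k, 1 ≤ k → d * k ≤ j → ∀ (q : Fin 2) (w : SpaceTimeIdx L M × SectorLeg (sectorCount (d * k - 1))),
        klWtPinnedSumOf L M β μ (klFlowFrameU L M β U μ n) (d * k - 1) 2 (klEffectiveAction L M β U μ (klFlowFrameU L M β U μ n) klE0 (d * k)) q w ≤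
          S₂ * ((4 : ℝ) ^ (d * k - 1))⁻¹) →
      (∀ j, d ≤ j → j ≤ n → ∀ k, 1 ≤ k → d * k ≤ j → ∀ (q : Fin 4) (τ' : Fin 4 → SectorLeg 1) (y' : SpaceTimeIdx L M),
        imagTimeWeight β M ^ 3 * ∑ x' ∈ univ.filter (fun x' : Fin 4 → SpaceTimeIdx L M => x' q = y'),
          klScaleWt L M β j ((univ.image x').image (fun x : SpaceTimeIdx L M => (((((2 * (x.1 : ℕ) : ℕ)) : ZMod (2 * (2 * M)))), x.2))) *
            ‖sectorisedKernel L M β (trivialMultiplier L M)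
              (ExteriorAlgebra.map (LinearMap.mulLeft ℂ (fun K : HubbardFieldIdx L M => ((gnScaleCutoff 4 klE0 1 |matsubaraFreq β M K.1.1.1| : ℝ) : ℂ))) (klTowerInput L M β U μ (klFlowFrameU L M β U μ n) d k)) 4 τ' x'‖ ≤ s₄ * (B * epsCoupling P U j)) →
      (∀ j, d ≤ j → j ≤ n → ∀ (q : Fin 6) (w : SpaceTimeIdx L M × SectorLeg (sectorCount (j - 1))),
        klWtPinnedSumOf L M β μ (klFlowFrameU L M β U μ n) (j - 1) 6 (klEffectiveAction L M β U μ (klFlowFrameU L M β U μ n) klE0 j) q w ≤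
          S₆ * epsCoupling P U j ^ 2 * (2 : ℝ) ^ (4 * j)) →
      -- the import amplitudes they induce (two-leg: `i₁ j = 2WZ·S₂/λ_j`, k3c2-p3's `importRowTwo_of_inputFamilyCell`; four-leg: the plain-line glue; `i₁ ι₁` RATE-INDEXED;
      -- six-leg: `ι₃` a NAME under two dominations [numerics] — block 1 from the base law (file C), blocks `k ≥ 2` from the input-family cell, `512·W·Z³·S₆·(M/β)⁵`)
      ∀ (i₁ ι₁ : ℕ → ℝ) (i₂ ι₂ ι₃ : ℝ), (∀ j, i₁ j = 2 * W * Z * (S₂ / (B * epsCoupling P U j))) →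
        i₂ = 16 * W * Z ^ 2 * klThinCountC * CWi ^ 4 * s₄ →
        (∀ j, ι₁ j = i₁ j * ((M : ℝ) / β)) → ι₂ = i₂ * ((M : ℝ) / β) ^ 3 → W * Z ^ 3 * (Ab * Qb ^ 3) ≤ ι₃ →
        512 * W * Z ^ 3 * S₆ * ((M : ℝ) / β) ^ 5 ≤ ι₃ →
      -- the kit's numerics at every read-out rate [p4 «part 4»]
      (∀ j, d ≤ j → j ≤ n →
        4 * σ * (B * epsCoupling P U j) * Q'' < 1 ∧ 2 * (B * epsCoupling P U j) * τ * Q'' ≤ 1 ∧ exp 1 * τ * (B * epsCoupling P U j) * Q'' < 1 ∧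
        Φ * (τ * (ι₁ j * (B * epsCoupling P U j) + ι₂ / (2 * Q'') + ι₃ / (4 * Q'' ^ 2) + A' * Q'' / 4)) < 1 ∧
        Φ * (exp 1 * τ * (ι₁ j * (B * epsCoupling P U j)) + (exp 1 * τ) ^ 2 * (ι₂ * (B * epsCoupling P U j)) +
          (exp 1 * τ) ^ 3 * (ι₃ * (B * epsCoupling P U j) ^ 2) +
          A' * (exp 1 * τ * Q'') * ((exp 1 * τ * (B * epsCoupling P U j) * Q'') ^ 3 / (1 - exp 1 * τ * (B * epsCoupling P U j) * Q''))) < 1 ∧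
        4 * Q'' ≤ Q' ∧ 2 * τ * ψ * Q'' ≤ Q' ∧
        A' * (4 * Q'') ^ 3 * (4 * σ * (B * epsCoupling P U j) * Q'' / (1 - 4 * σ * (B * epsCoupling P U j) * Q'')) +
          exp 1 * ψ * (2 * τ * ψ * Q'') ^ 2 * (τ * (ι₁ j * (B * epsCoupling P U j) + ι₂ / (2 * Q'') + ι₃ / (4 * Q'' ^ 2) + A' * Q'' / 4)) *
            (Φ * (τ * (ι₁ j * (B * epsCoupling P U j) + ι₂ / (2 * Q'') + ι₃ / (4 * Q'' ^ 2) + A' * Q'' / 4)) /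
              (1 - Φ * (τ * (ι₁ j * (B * epsCoupling P U j) + ι₂ / (2 * Q'') + ι₃ / (4 * Q'' ^ 2) + A' * Q'' / 4)))) ≤ A * Q' ^ 3) →
      -- the read-out constants level by level and the budget package's `CE` row [p4]
      ∀ (Qe : EngConsts) (Atot Qtot : ℕ → ℝ),
        (∀ j, Qtot j = max 1 (C₂i ^ 2) * max 1 (max (C₂r ^ 2 * max Q' Qb) (max (4 * Q'') (2 * τ * ψ * Q'')))) →
        (∀ j, Atot j = C₁r / C₂r * (Ab + A) + C₁i / C₂i * (A' * (4 * σ * (B * epsCoupling P U j) * Q'' / (1 - 4 * σ * (B * epsCoupling P U j) * Q'')) +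
          exp 1 * (τ * (ι₁ j * (B * epsCoupling P U j) + ι₂ / (2 * Q'') + ι₃ / (4 * Q'' ^ 2) + A' * Q'' / 4)) *
            (Φ * (τ * (ι₁ j * (B * epsCoupling P U j) + ι₂ / (2 * Q'') + ι₃ / (4 * Q'' ^ 2) + A' * Q'' / 4)) /
              (1 - Φ * (τ * (ι₁ j * (B * epsCoupling P U j) + ι₂ / (2 * Q'') + ι₃ / (4 * Q'' ^ 2) + A' * Q'' / 4)))) / (2 * τ * Q''))) →
        (∀ j, d ≤ j → j ≤ n → Qtot j * imagTimeWeight β M ^ 2 * B * max 1 (Atot j / imagTimeWeight β M) ≤ Qe.CE) → (klEngQ7 P R).IsRaiseOf Qe →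
      -- the six-leg threshold lifting the own-family `m = 6` clause (§2, amplitude `C₆c·16·S₆`) to the budget `klWtBudget P Qe U j 6` [numerics, lower bound on `Qe.CE`]
      C₆c * 16 * S₆ ≤ Qe.CE ^ 3 →
      -- the four-leg import CELL at `d ≤ j ≤ n`: the weighted PLAIN four-leg pinned line of `𝒱_j[K_n]` at `(F_j, rate j)` [E1] and its threshold [numerics]
      -- (the six-leg cell sits with the structural inputs above; the own-family `m = 6` clause is DERIVED from it here)
      ∀ (S₄ : ℕ → ℝ), (∀ j, 0 ≤ S₄ j) →
      (∀ j, d ≤ j → j ≤ n → ∀ (q : Fin 4) (τ' : Fin 4 → SectorLeg 1) (y' : SpaceTimeIdx L M),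
        imagTimeWeight β M ^ 3 * ∑ x' ∈ univ.filter (fun x' : Fin 4 → SpaceTimeIdx L M => x' q = y'),
          klScaleWt L M β j ((univ.image x').image (fun x : SpaceTimeIdx L M => (((((2 * (x.1 : ℕ) : ℕ)) : ZMod (2 * (2 * M)))), x.2))) *
            ‖sectorisedKernel L M β (trivialMultiplier L M)
              (ExteriorAlgebra.map (LinearMap.mulLeft ℂ (fun K : HubbardFieldIdx L M => ((gnScaleCutoff 4 klE0 1 |matsubaraFreq β M K.1.1.1| : ℝ) : ℂ))) (klEffectiveAction L M β U μ (klFlowFrameU L M β U μ n) klE0 j)) 4 τ' x'‖ ≤ S₄ j) →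
      (∀ j, d ≤ j → j ≤ n → klThinCountC * sectorCount j * (CW₄ ^ 4 * S₄ j) ≤ klWtBudget P Qe U j 4) →
      -- THE BLOCK-0 LEVELS `1 ≤ j < d`, weighted [p3 «WB4»]
      (∀ j, 1 ≤ j → j < d → j ≤ n → KernelNormsWt4 L M (klWtBudget P Qe U j) β U μ (klFlowFrameU L M β U μ n) j) →
      ∀ j, j ≤ n → KernelNormsWt4 L M (klWtBudget P Qe U j) β U μ (klFlowFrameU L M β U μ n) j) := by
  obtain ⟨C₁, C₂, Cκ, CJ, C₁r, C₂r, Cκr, CJr, C₁i, C₂i, hC₁, hC₂, hCκ, hCJ, hC₁r, hC₂r, hCκr, hCJr, hC₁i, hC₂i, hrowsU⟩ :=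
    kernelNormsWt4_all_klEng_rows_sharp4 R c'' hc''
  obtain ⟨CW₄, hCW₄, hc4⟩ := klWtPinnedSum_four_le_of_wplain_flow_all_cut R c'' hc''.le
  obtain ⟨C₆c, hC₆c, hc6rU⟩ := klWtPinnedSum_six_le_of_inputFamilyCell_klEng_flow_all R c'' hc''.le
  refine ⟨C₁, C₂, Cκ, CJ, C₁r, C₂r, Cκr, CJr, C₁i, C₂i, hC₁, hC₂, hCκ, hCJ, hC₁r, hC₂r, hCκr, hCJr, hC₁i, hC₂i, CW₄, C₆c, hCW₄, hC₆c, fun d => ?_⟩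
  obtain ⟨Cb, Cbr, hCb, hCbr, Cinc₁, Dinc₁, hCinc₁, hDinc₁, Cκ₀, CJ₀, Cα, hCκ₀, hCJ₀, hCα, hall⟩ := hrowsU d
  obtain ⟨Cκz, Cbz, CJz, hCκz, hCbz, hCJz, hZt⟩ := towerZ_blockZero_klEng d R c'' hc''
  obtain ⟨CWi, hCWi, himpW⟩ := importBindersWt_of_wplainLines_flow_all_cut4 d R c'' hc''.le
  refine ⟨Cb, Cbr, hCb, hCbr, Cinc₁, Dinc₁, hCinc₁, hDinc₁, Cκ₀, CJ₀, Cα, hCκ₀, hCJ₀, hCα, Cκz, Cbz, CJz, hCκz, hCbz, hCJz, CWi, hCWi,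
    fun hR2 => ?_⟩
  obtain ⟨c₃a, hc₃a, U₀a, hU₀a, hall'⟩ := hall hR2
  obtain ⟨c₃s, hc₃s, U₀s, hU₀s, hc6r⟩ := hc6rU hR2
  refine ⟨min (min c₃a (min (klThinCountC₃ R) (min (klThinCount6C₃ R) (klThinCount2C₃ R)))) c₃s,
    lt_min (lt_min hc₃a (lt_min (klThinCountC₃_pos R) (lt_min (klThinCount6C₃_pos R) (klThinCount2C₃_pos R)))) hc₃s,
    min (min U₀a (min (klThinCountU₀ R) (min (klThinCount6U₀ R) (klThinCount2U₀ R)))) U₀s,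
    lt_min (lt_min hU₀a (lt_min (klThinCountU₀_pos R) (lt_min (klThinCount6U₀_pos R) (klThinCount2U₀_pos R)))) hU₀s, fun P hP => ?_⟩
  obtain ⟨c₀, hc₀, U₁, hU₁, hZ1'⟩ := exists_partitionFn_scaleOne_ne_zero_unif P R hR2
  refine ⟨c₀, hc₀, U₁, hU₁, ?_⟩
  intro G Q c hc hc6 hc₃' hcc₀ μ hμ U hU hU9 hU₀' hUU₁ hcU β hβmin hβc L M _ _ hL3 hM3 n hn1 hnN hkl hhist hosc hd D hD3 hD hcard hD0
    B A Q' Ab Qb hB hA hQ hAb hQb Ab₀ Qb₀ hAb₀ hQb₀ αb₀ κb₀ crb₀ ccb₀ W₀ Z₀ σ₀ τ₀ ψ₀ Φ₀ hαb₀ hκb₀ hcrb₀ hccb₀ hW₀ hZ₀ hσ₀ hτ₀ hψ₀ hΦ₀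
    A'₀ Q'₀ ι₁₀ ι₂₀ ι₃₀ hA'₀ hQ'₀ hlawb₀ hblk0 Aro₁ Qro₁ Qtot₁ Atot₁ hAro₁ hQro₁ hQtot₁ hAtot₁ hAtotle hQtotQb
    κz αz crz ccz hκz hαz hcrz hccz hguardz
    κb αb crb ccb hκb hαb hcrb hccb hκbr hαbr hcrbr hccbr W Z σ τ ψ Φ hW hZ' hσ hτ hψ hΦ
    A' Q'' hA'1 hQ'1 hA'2 hQ'2 hQ'0 S₂ s₄ S₆ hS₂0 hs₄ hS₆ hC2in hS₄ hC6in i₁ ι₁ i₂ ι₂ ι₃ hi₁ hi₂ hι₁ hι₂ hdomAQ hdomS hnum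
    Qe Atot Qtot hQtot hAtot hCE hQe hT6 S₄ hS₄0 hL4 hT4 hlow' j hjn
  -- the folded doors
  have hc₃s' : c ≤ c₃s := hc₃'.trans (min_le_right _ _)
  have hU₀s' : U ≤ U₀s := hU₀'.trans (min_le_right _ _)
  replace hc₃' := hc₃'.trans (min_le_left _ _)
  replace hU₀' := hU₀'.trans (min_le_left _ _)
  have hc₃a' : c ≤ c₃a := hc₃'.trans (min_le_left _ _)
  have hcT : c ≤ klThinCountC₃ R := hc₃'.trans ((min_le_right _ _).trans (min_le_left _ _))
  have hcT6 : c ≤ klThinCount6C₃ R := hc₃'.trans ((min_le_right _ _).trans ((min_le_right _ _).trans (min_le_left _ _)))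
  have hcT2 : c ≤ klThinCount2C₃ R := hc₃'.trans ((min_le_right _ _).trans ((min_le_right _ _).trans (min_le_right _ _)))
  have hU₀a' : U ≤ U₀a := hU₀'.trans (min_le_left _ _)
  have hUT : U ≤ klThinCountU₀ R := hU₀'.trans ((min_le_right _ _).trans (min_le_left _ _))
  have hUT6 : U ≤ klThinCount6U₀ R := hU₀'.trans ((min_le_right _ _).trans ((min_le_right _ _).trans (min_le_left _ _)))
  have hUT2 : U ≤ klThinCount2U₀ R := hU₀'.trans ((min_le_right _ _).trans ((min_le_right _ _).trans (min_le_right _ _)))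
  have hU3g : U ≤ min (klEngU₀3 P R c) (1 / (R.Gfr 3 + 1)) :=
    le_min (hU9.trans (klEngU₀9_le_klEngU₀3 P R c)) (hU9.trans (klEngU₀9_le_inv_gfr_add_one P hR2.wf c (by norm_num)))
  have hβ : 0 < β := KLRegimeSplit.pos_of_klBetaMin_le hβmin
  have hK1 : 1 ≤ P.Klam := hP.1
  have hKl : 0 ≤ P.Klam := le_trans zero_le_one hK1
  have hB0 : 0 ≤ B := zero_le_one.trans hB
  have hM0 : (0 : ℝ) < M := Nat.cast_pos.2 (Nat.pos_of_ne_zero (NeZero.ne M))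
  have hfr : FrameOK R U (nScales β) μ (klFlowFrameU L M β U μ n) := frameOK_klFlowFrameU_of_histP_le hR2 hn1 le_rfl hnN hhist
  set K : TrigPolyC4v := klFlowFrameU L M β U μ n with hKdef
  -- `Z^{K_n}_{Λ_1} ≠ 0` (p3, c-uniform doors)
  have hZ1 : hubbardEffPartitionFnCT L M β U μ 0 K (klScale klE0 1) ≠ 0 :=
    hZ1' c hc hcc₀ μ hμ U hU hU9 hUU₁ β hβmin hβc L M hL3 hM3 K hfr
  -- the level `j = 0` (k3c2-p1's scale-zero theorem at `klEngQ7`, lifted along the raise) and the low levels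
  have hCE0 : 0 ≤ Qe.CE := (klEngQ7_wf P R).1.trans hQe.CE_le
  have hlow : ∀ j, j < d → j ≤ n → KernelNormsWt4 L M (klWtBudget P Qe U j) β U μ K j := by
    intro j hjd hjn
    rcases Nat.eq_zero_or_pos j with rfl | hj1
    · exact kernelNormsWt4_klWtBudget_of_isRaiseOf hQe (klEngQ7_wf P R).1 hKl
        (kernelNormsWt4_zero_klWtBudget_klEngQ7U9 P R c hP hR2 hc hc6 μ hμ U hU hU9 β hβmin hβc K hfr L M hL3 hM3)
    · exact hlow' j hj1 hjd hjn
  rcases Nat.lt_or_ge n d with hnd | hdn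
  · exact hlow j (by omega) hjn
  -- `d ≤ n`: `Z^{K_n}_{Λ_d} ≠ 0` from block 0's Z-thread at `j := d`
  have hZd : hubbardEffPartitionFnCT L M β U μ 0 K (klScale klE0 d) ≠ 0 :=
    hZt G P Q c hP hR2 hc hc6 μ hμ U hU hU9 hcU β hβmin hβc L M hL3 hM3 n hn1 hnN hkl hhist hfr hosc d (by omega) le_rfl hdn hZ1 D hD0
      κz αz crz ccz hκz hαz hcrz hccz (hguardz hdn)
  -- signs of the kit names
  have hcrb0 : 0 < crb := lt_of_lt_of_le (by positivity) hcrb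
  have hccb0 : 0 < ccb := lt_of_lt_of_le (by positivity) hccb
  have hW0 : 0 ≤ W := by rw [hW]; positivity
  have hZ0 : 0 ≤ Z := by rw [hZ']; positivity
  have hε0 : ∀ i, 0 ≤ epsCoupling P U i := fun i => epsCoupling_nonneg' hKl U i
  -- the two- and four-leg weighted import binders, rate by rate with `K_b := j / d`: TWO legs from the input-family cell ((C1″), k3c2-p3's reading),
  -- FOUR legs from the weighted plain line OF THE CUT INPUT through the cut twin of k3c2-p3's glue `importBindersWt_of_wplainLines_flow_all_cut4`
  have himp : ∀ j, d ≤ j → j ≤ n →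
      (∀ k, 1 ≤ k → d * k ≤ j → W * Z ^ 1 *
        (klTowerMeasWtAt L M β U μ K d k j (2 * 1) / klLevUnitF β M 0 1 (d * k - 1)) ≤ ι₁ j * (B * epsCoupling P U j)) ∧
      (∀ k, 1 ≤ k → d * k ≤ j → W * Z ^ 2 *
        (klTowerMeasWtAt L M β U μ K d k j (2 * 2) / klLevUnitF β M 0 2 (d * k - 1)) ≤ ι₂ * (B * epsCoupling P U j)) := by
    intro j hjd hjn
    have hdpos : 0 < d := by omega
    have hKb1 : 1 ≤ j / d := (Nat.le_div_iff_mul_le hdpos).2 (by simpa using hjd)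
    have hKbj : d * (j / d) ≤ j := by rw [mul_comm]; exact Nat.div_mul_le_self j d
    have hkK : ∀ k, d * k ≤ j → k ≤ j / d := fun k hk => (Nat.le_div_iff_mul_le hdpos).2 (by rw [mul_comm]; exact hk)
    have hεj : 0 < epsCoupling P U j := by
      unfold epsCoupling; have : 0 < P.Klam := by linarith
      positivity
    have hlamj : 0 < B * epsCoupling P U j := mul_pos (lt_of_lt_of_le one_pos hB) hεj
    -- the glue's TWO-leg and SIX-leg plain slots are fed the trivial finite bounds of their (finitely many) plain sums and their outputs DISCARDED
    -- ((R431) (C1″) / (R416) (C1′): both imports are read off input-family cells instead); only the four-leg output is kept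
    obtain ⟨s₂, hs₂, hS₂'⟩ : ∃ s₂ : ℝ, 0 ≤ s₂ ∧ ∀ k, 1 ≤ k → k ≤ j / d → ∀ (q : Fin 2) (τ' : Fin 2 → SectorLeg 1) (y' : SpaceTimeIdx L M),
        imagTimeWeight β M ^ 1 * ∑ x' ∈ univ.filter (fun x' : Fin 2 → SpaceTimeIdx L M => x' q = y'),
          klScaleWt L M β j ((univ.image x').image (fun x : SpaceTimeIdx L M => (((((2 * (x.1 : ℕ) : ℕ)) : ZMod (2 * (2 * M)))), x.2))) *
            ‖sectorisedKernel L M β (trivialMultiplier L M) (klTowerInput L M β U μ K d k) 2 τ' x'‖ ≤ s₂ * ((4 : ℝ) ^ (d * k - 1))⁻¹ * (B * epsCoupling P U j) := by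
      obtain ⟨C, hC⟩ := Finite.exists_le (fun a : Fin (j / d + 1) × Fin 2 × (Fin 2 → SectorLeg 1) × SpaceTimeIdx L M =>
        imagTimeWeight β M ^ 1 * ∑ x' ∈ univ.filter (fun x' : Fin 2 → SpaceTimeIdx L M => x' a.2.1 = a.2.2.2),
          klScaleWt L M β j ((univ.image x').image (fun x : SpaceTimeIdx L M => (((((2 * (x.1 : ℕ) : ℕ)) : ZMod (2 * (2 * M)))), x.2))) *
            ‖sectorisedKernel L M β (trivialMultiplier L M) (klTowerInput L M β U μ K d (a.1 : ℕ)) 2 a.2.2.1 x'‖)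
      refine ⟨max C 0 * (4 : ℝ) ^ (d * (j / d)) / (B * epsCoupling P U j), by positivity, fun k hk hkK q τ' y' => ?_⟩
      have h4 : (1 : ℝ) ≤ (4 : ℝ) ^ (d * (j / d)) * ((4 : ℝ) ^ (d * k - 1))⁻¹ := by
        rw [← div_eq_mul_inv, one_le_div (by positivity)]
        exact pow_le_pow_right₀ (by norm_num) (le_trans (Nat.sub_le _ _) (Nat.mul_le_mul_left d hkK))
      calc _ ≤ C := hC (⟨k, by omega⟩, q, τ', y')
        _ ≤ max C 0 * 1 := by rw [mul_one]; exact le_max_left _ _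
        _ ≤ max C 0 * ((4 : ℝ) ^ (d * (j / d)) * ((4 : ℝ) ^ (d * k - 1))⁻¹) := mul_le_mul_of_nonneg_left h4 (le_max_right _ _)
        _ = max C 0 * (4 : ℝ) ^ (d * (j / d)) / (B * epsCoupling P U j) * ((4 : ℝ) ^ (d * k - 1))⁻¹ * (B * epsCoupling P U j) := by
            field_simp
    obtain ⟨s₆, hs₆, hS₆'⟩ : ∃ s₆ : ℝ, 0 ≤ s₆ ∧ ∀ k, 1 ≤ k → k ≤ j / d → ∀ (q : Fin 6) (τ' : Fin 6 → SectorLeg 1) (y' : SpaceTimeIdx L M),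
        imagTimeWeight β M ^ 5 * ∑ x' ∈ univ.filter (fun x' : Fin 6 → SpaceTimeIdx L M => x' q = y'),
          klScaleWt L M β j ((univ.image x').image (fun x : SpaceTimeIdx L M => (((((2 * (x.1 : ℕ) : ℕ)) : ZMod (2 * (2 * M)))), x.2))) *
            ‖sectorisedKernel L M β (trivialMultiplier L M) (klTowerInput L M β U μ K d k) 6 τ' x'‖ ≤ s₆ * (B * epsCoupling P U j) ^ 2 := by
      obtain ⟨C, hC⟩ := Finite.exists_le (fun a : Fin (j / d + 1) × Fin 6 × (Fin 6 → SectorLeg 1) × SpaceTimeIdx L M =>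
        imagTimeWeight β M ^ 5 * ∑ x' ∈ univ.filter (fun x' : Fin 6 → SpaceTimeIdx L M => x' a.2.1 = a.2.2.2),
          klScaleWt L M β j ((univ.image x').image (fun x : SpaceTimeIdx L M => (((((2 * (x.1 : ℕ) : ℕ)) : ZMod (2 * (2 * M)))), x.2))) *
            ‖sectorisedKernel L M β (trivialMultiplier L M) (klTowerInput L M β U μ K d (a.1 : ℕ)) 6 a.2.2.1 x'‖)
      refine ⟨max C 0 / (B * epsCoupling P U j) ^ 2, by positivity, fun k hk hkK q τ' y' => ?_⟩
      rw [div_mul_cancel₀ _ (pow_pos hlamj 2).ne']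
      exact (hC (⟨k, by omega⟩, q, τ', y')).trans (le_max_left _ _)
    obtain ⟨-, h2, -⟩ := himpW G P Q c hR2 hc hc6 hcT hcT6 hcT2 μ hμ U hU hU3g hUT hUT6 hUT2 hcU β hβmin hβc L M hL3 hM3 n hn1 hnN hkl hhist hosc
      hd (j / d) j hKb1 hKbj hjn W Z (B * epsCoupling P U j) s₂ s₄ s₆ hW0 hZ0 (mul_nonneg hB0 (hε0 j)) hs₂ hs₄ hs₆ hS₂'
      (fun k hk hkK => hS₄ j hjd hjn k hk (le_trans (Nat.mul_le_mul_left d hkK) hKbj)) hS₆' (2 * W * Z * klThinCount2C * CWi ^ 2 * s₂) i₂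
      (131072 * W * Z ^ 3 * klThinCount6C * CWi ^ 6 * s₆) rfl hi₂ rfl
    refine ⟨fun k hk hkj => ?_, fun k hk hkj => ?_⟩
    · -- two legs: the input-family cell (C1″), read exactly as k3c2-p3's `importRowTwo_of_inputFamilyCell` (✓ p717660) does — anti-rate, `klTowerMeasWtAt_le_of_rows`,
      -- unit `klLevUnitF β M 0 1 J = ε·(4^J)⁻¹`, `ε = β/(2M)`: `W·Z·μ₁(k) ≤ W·Z·S₂/ε = 2·W·Z·S₂·(M/β) = ι₁ j·λ_j` (the arithmetic is inlined so that this file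
      -- does not wait for that module's olean — HUB-BUILD-LAG)
      have h40 : (0 : ℝ) < (4 : ℝ) ^ (d * k - 1) := by positivity
      have hx : 0 < imagTimeWeight β M := imagTimeWeight_pos_of_pos (M := M) hβ
      have hcell2 : ∀ (q : Fin 2) (w : SpaceTimeIdx L M × SectorLeg (sectorCount (d * k - 1))),
          klWtPinnedSumAt L M β μ K (d * k - 1) j 2 (klTowerInput L M β U μ K d k) q w ≤ S₂ * ((4 : ℝ) ^ (d * k - 1))⁻¹ := fun q w =>
        (klWtPinnedSumAt_le_klWtPinnedSumOf hβ.le μ K (by omega : d * k - 1 ≤ j) 2 _ q w).trans (hC2in j hjd hjn k hk hkj q w)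
      have hmeas2 : klTowerMeasWtAt L M β U μ K d k j 2 ≤ S₂ * ((4 : ℝ) ^ (d * k - 1))⁻¹ :=
        klTowerMeasWtAt_le_of_rows β U μ K d k j 2 rfl (by positivity) hcell2
      have hu1 : klLevUnitF β M 0 1 (d * k - 1) = imagTimeWeight β M * ((4 : ℝ) ^ (d * k - 1))⁻¹ := by
        have h8 : (8 : ℝ) ^ (d * k - 1) * (4 : ℝ) ^ (d * k - 1) = (2 : ℝ) ^ (5 * (d * k - 1)) := by
          rw [← mul_pow, show (8 : ℝ) * 4 = 2 ^ 5 by norm_num, ← pow_mul]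
        unfold klLevUnitF
        rw [show klLevGain 0 = 0 from rfl, zero_mul, pow_zero, show (2 * 1 - 1 : ℕ) = 1 from rfl, pow_one, Nat.mul_one, mul_div_assoc]
        congr 1
        rw [div_eq_iff (by positivity), inv_mul_eq_div, eq_div_iff h40.ne', h8, mul_one]
      have hq : klTowerMeasWtAt L M β U μ K d k j 2 / klLevUnitF β M 0 1 (d * k - 1) ≤ S₂ / imagTimeWeight β M := by
        have hu0 : 0 < klLevUnitF β M 0 1 (d * k - 1) := klLevUnitF_pos hβ 0 1 _
        refine (div_le_div_of_nonneg_right hmeas2 hu0.le).trans (le_of_eq ?_)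
        rw [hu1, mul_div_mul_right _ _ (ne_of_gt (inv_pos.2 h40))]
      have hε : S₂ / imagTimeWeight β M = 2 * S₂ * ((M : ℝ) / β) := by
        unfold imagTimeWeight; rw [div_div_eq_mul_div]; ring
      have hrow : W * Z ^ 1 * (klTowerMeasWtAt L M β U μ K d k j 2 / klLevUnitF β M 0 1 (d * k - 1)) ≤ 2 * W * Z * S₂ * ((M : ℝ) / β) :=
        calc W * Z ^ 1 * (klTowerMeasWtAt L M β U μ K d k j 2 / klLevUnitF β M 0 1 (d * k - 1))
            ≤ W * Z ^ 1 * (S₂ / imagTimeWeight β M) := mul_le_mul_of_nonneg_left hq (by positivity)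
          _ = 2 * W * Z * S₂ * ((M : ℝ) / β) := by rw [hε]; ring
      have heq : ι₁ j * (B * epsCoupling P U j) = 2 * W * Z * S₂ * ((M : ℝ) / β) := by
        rw [hι₁ j, hi₁ j]
        calc 2 * W * Z * (S₂ / (B * epsCoupling P U j)) * ((M : ℝ) / β) * (B * epsCoupling P U j)
            = 2 * W * Z * ((M : ℝ) / β) * (S₂ / (B * epsCoupling P U j) * (B * epsCoupling P U j)) := by ring
          _ = 2 * W * Z * ((M : ℝ) / β) * S₂ := by rw [div_mul_cancel₀ _ hlamj.ne']
          _ = 2 * W * Z * S₂ * ((M : ℝ) / β) := by ring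
      show W * Z ^ 1 * (klTowerMeasWtAt L M β U μ K d k j 2 / klLevUnitF β M 0 1 (d * k - 1)) ≤ ι₁ j * (B * epsCoupling P U j)
      rw [heq]; exact hrow
    · rw [hι₂]; exact h2 k hk (hkK k hkj)
  -- (C1′) §1: the six-leg import rows at blocks `k ≥ 2` READ BY NAME off the input-family cell at `j = dk` (k3c2-p3's `importRowSix_of_inputFamilyCell`),
  -- then `ε_{dk} ≤ ε_j ≤ B·ε_j` and the domination `512·W·Z³·S₆·(M/β)⁵ ≤ ι₃`
  have hεmono : ∀ {a b : ℕ}, a ≤ b → epsCoupling P U a ≤ epsCoupling P U b := fun {a b} hab => by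
    unfold epsCoupling
    exact mul_le_mul_of_nonneg_left ((add_le_add_iff_left |U|).2 (mul_le_mul_of_nonneg_left (Nat.cast_le.2 hab) (sq_nonneg U))) hKl
  have hι₃' : ∀ j, d ≤ j → j ≤ n → ∀ k, 2 ≤ k → d * k ≤ j → W * Z ^ 3 *
      (klTowerMeasWtAt L M β U μ K d k j (2 * 3) / klLevUnitF β M 0 3 (d * k - 1)) ≤ ι₃ * (B * epsCoupling P U j) ^ 2 := by
    intro j hjd hjn k hk2 hkj
    have hdk : d ≤ d * k := Nat.le_mul_of_pos_right d (by omega)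
    have hrow := importRowSix_of_inputFamilyCell (L := L) (M := M) hβ U μ K P d k (by omega) (by omega : d * k - 1 ≤ j) hW0 hZ0 hS₆
      (hC6in (d * k) hdk (hkj.trans hjn))
    have hεB : epsCoupling P U (d * k) ^ 2 ≤ (B * epsCoupling P U j) ^ 2 :=
      pow_le_pow_left₀ (hε0 _) ((hεmono hkj).trans (le_mul_of_one_le_left (hε0 j) hB)) 2
    show W * Z ^ 3 * (klTowerMeasWtAt L M β U μ K d k j 6 / klLevUnitF β M 0 3 (d * k - 1)) ≤ ι₃ * (B * epsCoupling P U j) ^ 2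
    calc W * Z ^ 3 * (klTowerMeasWtAt L M β U μ K d k j 6 / klLevUnitF β M 0 3 (d * k - 1))
        ≤ 512 * W * Z ^ 3 * S₆ * ((M : ℝ) / β) ^ 5 * epsCoupling P U (d * k) ^ 2 := hrow
      _ ≤ 512 * W * Z ^ 3 * S₆ * ((M : ℝ) / β) ^ 5 * (B * epsCoupling P U j) ^ 2 := mul_le_mul_of_nonneg_left hεB (by positivity)
      _ ≤ ι₃ * (B * epsCoupling P U j) ^ 2 := mul_le_mul_of_nonneg_right hdomS (pow_nonneg (mul_nonneg hB0 (hε0 j)) 2)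
  -- the two import cells: weighted plain lines (k3c2-p3) + thresholds at `d ≤ j`, the low levels below `d`
  have hcell4 : ∀ j, j ≤ n → ∀ (q : Fin 4) (w : SpaceTimeIdx L M × SectorLeg (sectorCount j)),
      klWtPinnedSum L M β U μ K j 4 q w ≤ klWtBudget P Qe U j 4 := by
    intro j hjn q w
    rcases Nat.lt_or_ge j d with hjd | hjd
    · exact hlow j hjd hjn 4 (by norm_num) q w
    · exact (hc4 G P Q c hR2 hc hc6 hcT μ hμ U hU hU3g hUT hcU β hβmin hβc L M hL3 hM3 n hn1 hnN hkl hhist hosc j (by omega) hjn q w (S₄ j) (hS₄0 j)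
        (fun τ' y' => hL4 j hjd hjn q τ' y')).trans (hT4 j hjd hjn)
  -- (C1′) §2: the own-family six-leg cell at `d ≤ j` from the input-family cell by ONE refinement level (k3c2-p3's
  -- `klWtPinnedSum_six_le_of_inputFamilyCell_klEng_flow_all`, amplitude `C₆c·16·S₆`), lifted to the budget by `C₆c·16·S₆ ≤ Qe.CE³`; below `d` off the low levels
  have hcell6 : ∀ j, j ≤ n → ∀ (q : Fin 6) (w : SpaceTimeIdx L M × SectorLeg (sectorCount j)),
      klWtPinnedSum L M β U μ K j 6 q w ≤ klWtBudget P Qe U j 6 := by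
    intro j hjn q w
    rcases Nat.lt_or_ge j d with hjd | hjd
    · exact hlow j hjd hjn 6 (by norm_num) q w
    · have hB6 : 0 ≤ S₆ * epsCoupling P U j ^ 2 * (2 : ℝ) ^ (4 * j) := by positivity
      refine (hc6r G P Q c hc hc6 hc₃s' μ hμ U hU hU3g hU₀s' hcU β hβmin hβc L M hL3 hM3 n hn1 hnN hkl hhist hosc j (by omega) hjn _ hB6
        (hC6in j hjd hjn) q w).trans ?_
      rw [klWtBudget_six_eq]
      calc C₆c * 16 * (S₆ * epsCoupling P U j ^ 2 * (2 : ℝ) ^ (4 * j)) = (C₆c * 16 * S₆) * (epsCoupling P U j ^ 2 * (2 : ℝ) ^ (4 * j)) := by ring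
        _ ≤ Qe.CE ^ 3 * (epsCoupling P U j ^ 2 * (2 : ℝ) ^ (4 * j)) := mul_le_mul_of_nonneg_right hT6 (by positivity)
        _ = Qe.CE ^ 3 * epsCoupling P U j ^ 2 * (2 : ℝ) ^ (4 * j) := by ring
  exact hall' G P Q c hP hc hc6 hc₃a' μ hμ U hU hU9 hU₀a' hcU β hβmin hβc L M hL3 hM3 n hn1 hnN hkl hhist hosc hd hdn D hD3 hD hcard hD0
    B A Q' Ab Qb hB hA hQ hAb hQb hZ1 hZd Ab₀ Qb₀ hAb₀ hQb₀ αb₀ κb₀ crb₀ ccb₀ W₀ Z₀ σ₀ τ₀ ψ₀ Φ₀ hαb₀ hκb₀ hcrb₀ hccb₀ hW₀ hZ₀ hσ₀ hτ₀ hψ₀ hΦ₀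
    A'₀ Q'₀ ι₁₀ ι₂₀ ι₃₀ hA'₀ hQ'₀ hlawb₀ hblk0 Aro₁ Qro₁ Qtot₁ Atot₁ hAro₁ hQro₁ hQtot₁ hAtot₁ hAtotle hQtotQb
    κb αb crb ccb hκb hαb hcrb hccb hκbr hαbr hcrbr hccbr W Z σ τ ψ Φ hW hZ' hσ hτ hψ hΦ
    A' Q'' hA'1 hQ'1 hA'2 hQ'2 hQ'0 ι₁ ι₂ ι₃ (fun j hjd hjn => (himp j hjd hjn).1) (fun j hjd hjn => (himp j hjd hjn).2) hdomAQ
    hι₃' hnum Qe Atot Qtot hQtot hAtot hCE hCE0 hcell4 hcell6 hlow j hjn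

end Summit.HubbardSuperconductivity.HubbardSuperconductivity.Theorems.EngineV8

end
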